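import Summits.BirchSwinnertonDyer.BirchSwinnertonDyer.Theorems.ResidualThetaTransportAtTwoLambdaLowerBoundOEulerFactor
import HarnessLib

/-!
# `λ` of the QUADRATIC local Euler-factor module `Λ_𝒪/((Y² − aY + ℓ))`, `Y = (1+T)^{p^k}`: `p^k` times the
# multiplicity of `1` as a root of `Ȳ² − āȲ + ℓ̄` — the Greenberg–Vatsal local term `s_ℓ · d_ℓ` of the CM
# partner `g` at a prime `ℓ ∤ M` of `S₀` (the `ℓ ∤ M` summand of the crux's `Σ_g(S₀)`); and the `ℓ ∣ M`
# summand `Λ_𝒪/((ℓ − aY))`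

Route `ResidualThetaTransportAtTwo` (RTT), crux (R≥)ᵖ `ResidualThetaCountLowerPureAtTwo`
(stmt-BirchSwinnertonDyer-26074), line «bt26-lambda», research stub S2 `stub_cmLambdaLower`, step (f5)
(imprimitivity) of `Cruxes/ResidualThetaCountLowerPureAtTwo/LINE-DESIGN-g11.md` §2; width seat
`prover-bsd-rtt-w1` g0 (helper (H2) of the rtt-w2 census 2026-08-28; `--supports`, closes nothing).
HONEST FRAMING: THEOREMS ONLY (no definition, no named fact, no instance, no `sorry`); pure commutative
algebra; nothing about any Selmer group, Galois cohomology group or modular form is asserted; BSD is not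
proved by any of this.

WHY. In the `S₀`-imprimitive λ-count on the CM side (Greenberg–Vatsal 2000 §2, Prop. 2.4 and Cor. 2.3, read
over `𝒪 = 𝒪_λ` at `p = 2`), a prime `ℓ ≠ p` with `s_ℓ = p^k` primes of `ℚ_∞` above it contributes the
Pontryagin dual of `∏_{η ∣ ℓ} H¹(ℚ_{∞,η}, A_g)`, which is the cyclic `Λ_𝒪`-module `Λ_𝒪/(𝓟_ℓ)` with
`𝓟_ℓ = P_ℓ(ℓ⁻¹γ_ℓ)`, `γ_ℓ ↦ Y = (1+T)^{p^k}` (after the harmless substitution `1+T ↦ (1+T)^{unit}`, exactly as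
in the companion file `…LambdaLowerBoundOEulerFactor`, p627158, which treats ONE Frobenius root `Y − u`).
For the partner newform `g` the Euler polynomial is QUADRATIC with coefficients in `𝒪` (its roots need not lie
in `𝒪`): `P_ℓ(X) = 1 − a_ℓX + ℓX²` at `ℓ ∤ M`, so `ℓ·𝓟_ℓ = Y² − a_ℓY + ℓ`; and LINEAR `P_ℓ(X) = 1 − a_ℓX` at
`ℓ ∣ M`, so `ℓ·𝓟_ℓ = ℓ − a_ℓY` (`ℓ` is a unit of `𝒪`). This file computes the λ-invariant (= `𝒪`-rank, the
module is free) of both quotients WITHOUT factoring the polynomial: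

* §1 (any local ring `O` with residue characteristic `p`) `map_residue_onePlusX_pow` — `(1+T)^{p^k} ↦ 1 + T^{p^k}`
  mod `𝔪`; `map_residue_eulerQuadratic` — `Y² − aY + ℓ ↦ C(1 − ā + ℓ̄) + C(2 − ā)·T^{p^k} + T^{2p^k}`;
  `map_residue_eulerLinear` — `ℓ − aY ↦ C(ℓ̄ − ā) + C(−ā)·T^{p^k}`; and the `T`-orders of these normal
  forms (`order_C_add_C_mul_X_pow_add_X_pow_*`, `order_C_add_C_mul_X_pow_*`): `0`, `p^k` or `2p^k`
  according as `P̄(1) ≠ 0`; `P̄(1) = 0 ≠ P̄'(1)`; `P̄(1) = 0 = P̄'(1)` — i.e. `p^k ·` (multiplicity of `1` as a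
  root of `Ȳ² − āȲ + ℓ̄`), which is GV's `s_ℓ · d_ℓ` (`d_ℓ` = multiplicity of `ℓ̄⁻¹` as a root of `P̄_ℓ`).
* §2 (over `𝒪 = 𝒪_E`, `E/ℚ_p` finite) `free_finrank_quotient_span_eulerQuadratic_of_*` (three cases) and
  `free_finrank_quotient_span_eulerLinear_of_*` (two cases): the quotient is FREE over `𝒪` of that rank
  (Weierstrass preparation, `free_finrank_quotient_span_of_order_eq`, p625410).
The case `p = 2`, `ℓ` odd, in the crux's own norm currency (`‖a‖ < 1`, `‖a − 1‖ < 1`) and on the crux's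
carriers `padicCoeffIntegers S` / `IwasawaAlgebraO S` is the sequel `…EulerFactorQuadraticAtTwo`.

References: [GreenbergVatsal2000] §2, Prop. 2.4 (the computation `λ(𝓟_ℓ) = s_ℓ d_ℓ`, `d_ℓ` the
multiplicity of `ℓ̃⁻¹` as a root of `P̃_ℓ`) and Cor. 2.3; [Washington1997] §7.1 Thm. 7.3 (Weierstrass
preparation).
-/

set_option autoImplicit false
-- the Theorems namespace of this sub repeats the summit name by design (D-0017 nested layout)
set_option linter.dupNamespace false

noncomputable section

open scoped Classical
open PowerSeries

namespace Summit.BirchSwinnertonDyer.BirchSwinnertonDyer.Theorems.LambdaLowerBoundO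

universe u

/-! ### §1. Residual normal forms and their `T`-orders -/

section Orders

variable {K : Type u} [Semiring K]

/-- `ord_T(C c₀ + C c₁·T^n + T^{2n}) = 0` when `c₀ ≠ 0` (`n ≠ 0`). [folklore] -/
theorem order_C_add_C_mul_X_pow_add_X_pow_of_ne_zero {n : ℕ} (hn : n ≠ 0) {c₀ c₁ : K} (h₀ : c₀ ≠ 0) :
    (C c₀ + C c₁ * X ^ n + (X : PowerSeries K) ^ (2 * n)).order = ((0 : ℕ) : ℕ∞) := by
  rw [order_eq_nat]
  refine ⟨?_, fun i hi => absurd hi (Nat.not_lt_zero i)⟩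
  have h2n : (0 : ℕ) ≠ 2 * n := by omega
  simpa [coeff_C, coeff_C_mul_X_pow, coeff_X_pow, hn, hn.symm, h2n, h2n.symm] using h₀

/-- `ord_T(C 0 + C c₁·T^n + T^{2n}) = n` when `c₁ ≠ 0` (`n ≠ 0`). [folklore] -/
theorem order_C_add_C_mul_X_pow_add_X_pow_of_eq_zero_of_ne_zero {n : ℕ} (hn : n ≠ 0) {c₀ c₁ : K}
    (h₀ : c₀ = 0) (h₁ : c₁ ≠ 0) :
    (C c₀ + C c₁ * X ^ n + (X : PowerSeries K) ^ (2 * n)).order = ((n : ℕ) : ℕ∞) := by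
  subst h₀
  rw [order_eq_nat]
  have h2n : n ≠ 2 * n := by omega
  refine ⟨?_, fun i hi => ?_⟩
  · simpa [coeff_C, coeff_C_mul_X_pow, coeff_X_pow, hn, hn.symm, h2n, h2n.symm] using h₁
  · have hi0 : i ≠ n := hi.ne
    have hi2 : i ≠ 2 * n := by omega
    simp [coeff_X_pow, hi0, hi2]

/-- `ord_T(C 0 + C 0·T^n + T^{2n}) = 2n`. [folklore] -/
theorem order_C_add_C_mul_X_pow_add_X_pow_of_eq_zero_of_eq_zero [Nontrivial K] (n : ℕ) {c₀ c₁ : K}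
    (h₀ : c₀ = 0) (h₁ : c₁ = 0) :
    (C c₀ + C c₁ * X ^ n + (X : PowerSeries K) ^ (2 * n)).order = ((2 * n : ℕ) : ℕ∞) := by
  subst h₀ h₁
  simp only [map_zero, zero_mul, zero_add, order_X_pow]

/-- `ord_T(C c₀ + C c₁·T^n) = 0` when `c₀ ≠ 0` (`n ≠ 0`). [folklore] -/
theorem order_C_add_C_mul_X_pow_of_ne_zero {n : ℕ} (hn : n ≠ 0) {c₀ c₁ : K} (h₀ : c₀ ≠ 0) :
    (C c₀ + C c₁ * (X : PowerSeries K) ^ n).order = ((0 : ℕ) : ℕ∞) := by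
  rw [order_eq_nat]
  refine ⟨?_, fun i hi => absurd hi (Nat.not_lt_zero i)⟩
  simpa [coeff_C, coeff_C_mul_X_pow, hn, hn.symm] using h₀

/-- `ord_T(C 0 + C c₁·T^n) = n` when `c₁ ≠ 0`. [folklore] -/
theorem order_C_add_C_mul_X_pow_of_eq_zero_of_ne_zero {n : ℕ} {c₀ c₁ : K} (h₀ : c₀ = 0) (h₁ : c₁ ≠ 0) :
    (C c₀ + C c₁ * (X : PowerSeries K) ^ n).order = ((n : ℕ) : ℕ∞) := by
  subst h₀
  rw [order_eq_nat]
  refine ⟨?_, fun i hi => ?_⟩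
  · simpa [coeff_C, coeff_C_mul_X_pow] using h₁
  · have hi0 : i ≠ n := hi.ne
    simp [hi0]

end Orders

section Residual

variable {O : Type u} [CommRing O] [IsLocalRing O] (p : ℕ) [Fact p.Prime]
  [CharP (IsLocalRing.ResidueField O) p]

/-- **Freshman's dream**: `(1+T)^{p^k} ↦ 1 + T^{p^k}` modulo `𝔪`. [folklore] -/
theorem map_residue_onePlusX_pow (k : ℕ) :
    (((1 : PowerSeries O) + X) ^ (p ^ k)).map (IsLocalRing.residue O) =
      1 + (X : PowerSeries (IsLocalRing.ResidueField O)) ^ (p ^ k) := by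
  haveI : CharP (PowerSeries (IsLocalRing.ResidueField O)) p :=
    charP_of_injective_algebraMap (algebraMap (IsLocalRing.ResidueField O) _).injective p
  rw [map_pow, map_add, map_one, map_X, add_pow_char_pow, one_pow]

/-- **The quadratic Euler-factor series modulo `𝔪`**: with `Y = (1+T)^{p^k}`,
`Y² − aY + ℓ ↦ C(1 − ā + ℓ̄) + C(2 − ā)·T^{p^k} + T^{2p^k}` (`P̄(1)` and `P̄'(1)` for `P̄ = Ȳ² − āȲ + ℓ̄`).
[cite: GreenbergVatsal2000, §2 Prop. 2.4] -/
theorem map_residue_eulerQuadratic (k : ℕ) (a l : O) :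
    ((((1 : PowerSeries O) + X) ^ (p ^ k)) ^ 2 - C a * ((1 : PowerSeries O) + X) ^ (p ^ k) + C l).map
        (IsLocalRing.residue O) =
      C (1 - IsLocalRing.residue O a + IsLocalRing.residue O l) +
        C (2 - IsLocalRing.residue O a) * X ^ (p ^ k) +
        (X : PowerSeries (IsLocalRing.ResidueField O)) ^ (2 * p ^ k) := by
  haveI : CharP (PowerSeries (IsLocalRing.ResidueField O)) p :=
    charP_of_injective_algebraMap (algebraMap (IsLocalRing.ResidueField O) _).injective p
  simp only [map_add, map_sub, map_mul, map_pow, map_C, map_one, map_X, map_ofNat]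
  rw [add_pow_char_pow, one_pow]
  ring

/-- **The linear Euler-factor series modulo `𝔪`**: with `Y = (1+T)^{p^k}`,
`ℓ − aY ↦ C(ℓ̄ − ā) + C(−ā)·T^{p^k}`. [cite: GreenbergVatsal2000, §2 Prop. 2.4] -/
theorem map_residue_eulerLinear (k : ℕ) (a l : O) :
    (C l - C a * ((1 : PowerSeries O) + X) ^ (p ^ k)).map (IsLocalRing.residue O) =
      C (IsLocalRing.residue O l - IsLocalRing.residue O a) +
        C (-IsLocalRing.residue O a) * (X : PowerSeries (IsLocalRing.ResidueField O)) ^ (p ^ k) := by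
  simp only [map_sub, map_mul, map_C, map_residue_onePlusX_pow p k, map_neg]
  ring

/-- `ord_T((Y² − aY + ℓ) mod 𝔪) = 0` when `P̄(1) = 1 − ā + ℓ̄ ≠ 0` (no root at `1`).
[cite: GreenbergVatsal2000, §2 Prop. 2.4] -/
theorem order_map_eulerQuadratic_of_ne_zero (k : ℕ) {a l : O}
    (h : 1 - IsLocalRing.residue O a + IsLocalRing.residue O l ≠ 0) :
    (((((1 : PowerSeries O) + X) ^ (p ^ k)) ^ 2 - C a * ((1 : PowerSeries O) + X) ^ (p ^ k) + C l).map
        (IsLocalRing.residue O)).order = ((0 : ℕ) : ℕ∞) := by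
  rw [map_residue_eulerQuadratic p]
  exact order_C_add_C_mul_X_pow_add_X_pow_of_ne_zero (pow_ne_zero _ (Fact.out : p.Prime).ne_zero) h

/-- `ord_T((Y² − aY + ℓ) mod 𝔪) = p^k` when `P̄(1) = 0` and `P̄'(1) = 2 − ā ≠ 0` (a simple root at `1`).
[cite: GreenbergVatsal2000, §2 Prop. 2.4] -/
theorem order_map_eulerQuadratic_of_eq_zero_of_ne_zero (k : ℕ) {a l : O}
    (h : 1 - IsLocalRing.residue O a + IsLocalRing.residue O l = 0) (h' : 2 - IsLocalRing.residue O a ≠ 0) :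
    (((((1 : PowerSeries O) + X) ^ (p ^ k)) ^ 2 - C a * ((1 : PowerSeries O) + X) ^ (p ^ k) + C l).map
        (IsLocalRing.residue O)).order = ((p ^ k : ℕ) : ℕ∞) := by
  rw [map_residue_eulerQuadratic p]
  exact order_C_add_C_mul_X_pow_add_X_pow_of_eq_zero_of_ne_zero
    (pow_ne_zero _ (Fact.out : p.Prime).ne_zero) h h'

/-- `ord_T((Y² − aY + ℓ) mod 𝔪) = 2p^k` when `P̄(1) = 0 = P̄'(1)` (a double root at `1`).
[cite: GreenbergVatsal2000, §2 Prop. 2.4] -/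
theorem order_map_eulerQuadratic_of_eq_zero_of_eq_zero (k : ℕ) {a l : O}
    (h : 1 - IsLocalRing.residue O a + IsLocalRing.residue O l = 0) (h' : 2 - IsLocalRing.residue O a = 0) :
    (((((1 : PowerSeries O) + X) ^ (p ^ k)) ^ 2 - C a * ((1 : PowerSeries O) + X) ^ (p ^ k) + C l).map
        (IsLocalRing.residue O)).order = ((2 * p ^ k : ℕ) : ℕ∞) := by
  rw [map_residue_eulerQuadratic p]
  exact order_C_add_C_mul_X_pow_add_X_pow_of_eq_zero_of_eq_zero (p ^ k) h h'

/-- `ord_T((ℓ − aY) mod 𝔪) = 0` when `ℓ̄ ≠ ā`. [cite: GreenbergVatsal2000, §2 Prop. 2.4] -/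
theorem order_map_eulerLinear_of_ne (k : ℕ) {a l : O}
    (h : IsLocalRing.residue O l ≠ IsLocalRing.residue O a) :
    ((C l - C a * ((1 : PowerSeries O) + X) ^ (p ^ k)).map (IsLocalRing.residue O)).order =
      ((0 : ℕ) : ℕ∞) := by
  rw [map_residue_eulerLinear p]
  exact order_C_add_C_mul_X_pow_of_ne_zero (pow_ne_zero _ (Fact.out : p.Prime).ne_zero) (sub_ne_zero.2 h)

/-- `ord_T((ℓ − aY) mod 𝔪) = p^k` when `ℓ̄ = ā ≠ 0`. [cite: GreenbergVatsal2000, §2 Prop. 2.4] -/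
theorem order_map_eulerLinear_of_eq (k : ℕ) {a l : O}
    (h : IsLocalRing.residue O l = IsLocalRing.residue O a) (h0 : IsLocalRing.residue O a ≠ 0) :
    ((C l - C a * ((1 : PowerSeries O) + X) ^ (p ^ k)).map (IsLocalRing.residue O)).order =
      ((p ^ k : ℕ) : ℕ∞) := by
  rw [map_residue_eulerLinear p]
  exact order_C_add_C_mul_X_pow_of_eq_zero_of_ne_zero (sub_eq_zero.2 h) (neg_ne_zero.2 h0)

end Residual

/-! ### §2. Over `𝒪 = 𝒪_E`: the quotients are free of rank `0`, `p^k`, `2p^k` -/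

section UnitBall

open Literature.NumberTheory.Automorphic

variable (p : ℕ) [Fact p.Prime] (E : IntermediateField ℚ_[p] (PadicAlgCl p)) [FiniteDimensional ℚ_[p] E]

/-- **`λ(Λ_𝒪/((Y² − aY + ℓ))) = 0` when `1` is not a root of `Ȳ² − āȲ + ℓ̄`**: the quotient is free of rank `0`
over `𝒪 = 𝒪_E`. [cite: GreenbergVatsal2000, §2 Prop. 2.4] [cite: Washington1997, §7.1 Thm. 7.3] -/
theorem free_finrank_quotient_span_eulerQuadratic_of_ne_zero (k : ℕ)
    {a l : PadicIntermediateField.unitBall p E}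
    (h : 1 - IsLocalRing.residue (PadicIntermediateField.unitBall p E) a +
      IsLocalRing.residue (PadicIntermediateField.unitBall p E) l ≠ 0) :
    Module.Free (PadicIntermediateField.unitBall p E)
        (PowerSeries (PadicIntermediateField.unitBall p E) ⧸
          Ideal.span {(((1 : PowerSeries (PadicIntermediateField.unitBall p E)) + X) ^ (p ^ k)) ^ 2 -
            C a * ((1 : PowerSeries (PadicIntermediateField.unitBall p E)) + X) ^ (p ^ k) + C l}) ∧
      Module.Finite (PadicIntermediateField.unitBall p E)
        (PowerSeries (PadicIntermediateField.unitBall p E) ⧸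
          Ideal.span {(((1 : PowerSeries (PadicIntermediateField.unitBall p E)) + X) ^ (p ^ k)) ^ 2 -
            C a * ((1 : PowerSeries (PadicIntermediateField.unitBall p E)) + X) ^ (p ^ k) + C l}) ∧
      Module.finrank (PadicIntermediateField.unitBall p E)
        (PowerSeries (PadicIntermediateField.unitBall p E) ⧸
          Ideal.span {(((1 : PowerSeries (PadicIntermediateField.unitBall p E)) + X) ^ (p ^ k)) ^ 2 -
            C a * ((1 : PowerSeries (PadicIntermediateField.unitBall p E)) + X) ^ (p ^ k) + C l}) = 0 := by
  haveI := charP_residueField_unitBall p E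
  exact free_finrank_quotient_span_of_order_eq p E _ 0 (order_map_eulerQuadratic_of_ne_zero p k h)

/-- **`λ(Λ_𝒪/((Y² − aY + ℓ))) = p^k` when `1` is a simple root of `Ȳ² − āȲ + ℓ̄`**: the quotient is free of
rank `p^k` over `𝒪 = 𝒪_E`. [cite: GreenbergVatsal2000, §2 Prop. 2.4] [cite: Washington1997, §7.1 Thm. 7.3] -/
theorem free_finrank_quotient_span_eulerQuadratic_of_eq_zero_of_ne_zero (k : ℕ)
    {a l : PadicIntermediateField.unitBall p E}
    (h : 1 - IsLocalRing.residue (PadicIntermediateField.unitBall p E) a +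
      IsLocalRing.residue (PadicIntermediateField.unitBall p E) l = 0)
    (h' : 2 - IsLocalRing.residue (PadicIntermediateField.unitBall p E) a ≠ 0) :
    Module.Free (PadicIntermediateField.unitBall p E)
        (PowerSeries (PadicIntermediateField.unitBall p E) ⧸
          Ideal.span {(((1 : PowerSeries (PadicIntermediateField.unitBall p E)) + X) ^ (p ^ k)) ^ 2 -
            C a * ((1 : PowerSeries (PadicIntermediateField.unitBall p E)) + X) ^ (p ^ k) + C l}) ∧
      Module.Finite (PadicIntermediateField.unitBall p E)
        (PowerSeries (PadicIntermediateField.unitBall p E) ⧸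
          Ideal.span {(((1 : PowerSeries (PadicIntermediateField.unitBall p E)) + X) ^ (p ^ k)) ^ 2 -
            C a * ((1 : PowerSeries (PadicIntermediateField.unitBall p E)) + X) ^ (p ^ k) + C l}) ∧
      Module.finrank (PadicIntermediateField.unitBall p E)
        (PowerSeries (PadicIntermediateField.unitBall p E) ⧸
          Ideal.span {(((1 : PowerSeries (PadicIntermediateField.unitBall p E)) + X) ^ (p ^ k)) ^ 2 -
            C a * ((1 : PowerSeries (PadicIntermediateField.unitBall p E)) + X) ^ (p ^ k) + C l}) = p ^ k := by
  haveI := charP_residueField_unitBall p E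
  exact free_finrank_quotient_span_of_order_eq p E _ (p ^ k)
    (order_map_eulerQuadratic_of_eq_zero_of_ne_zero p k h h')

/-- **`λ(Λ_𝒪/((Y² − aY + ℓ))) = 2p^k` when `1` is a double root of `Ȳ² − āȲ + ℓ̄`**: the quotient is free of
rank `2p^k` over `𝒪 = 𝒪_E`. [cite: GreenbergVatsal2000, §2 Prop. 2.4] [cite: Washington1997, §7.1 Thm. 7.3] -/
theorem free_finrank_quotient_span_eulerQuadratic_of_eq_zero_of_eq_zero (k : ℕ)
    {a l : PadicIntermediateField.unitBall p E}
    (h : 1 - IsLocalRing.residue (PadicIntermediateField.unitBall p E) a +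
      IsLocalRing.residue (PadicIntermediateField.unitBall p E) l = 0)
    (h' : 2 - IsLocalRing.residue (PadicIntermediateField.unitBall p E) a = 0) :
    Module.Free (PadicIntermediateField.unitBall p E)
        (PowerSeries (PadicIntermediateField.unitBall p E) ⧸
          Ideal.span {(((1 : PowerSeries (PadicIntermediateField.unitBall p E)) + X) ^ (p ^ k)) ^ 2 -
            C a * ((1 : PowerSeries (PadicIntermediateField.unitBall p E)) + X) ^ (p ^ k) + C l}) ∧
      Module.Finite (PadicIntermediateField.unitBall p E)
        (PowerSeries (PadicIntermediateField.unitBall p E) ⧸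
          Ideal.span {(((1 : PowerSeries (PadicIntermediateField.unitBall p E)) + X) ^ (p ^ k)) ^ 2 -
            C a * ((1 : PowerSeries (PadicIntermediateField.unitBall p E)) + X) ^ (p ^ k) + C l}) ∧
      Module.finrank (PadicIntermediateField.unitBall p E)
        (PowerSeries (PadicIntermediateField.unitBall p E) ⧸
          Ideal.span {(((1 : PowerSeries (PadicIntermediateField.unitBall p E)) + X) ^ (p ^ k)) ^ 2 -
            C a * ((1 : PowerSeries (PadicIntermediateField.unitBall p E)) + X) ^ (p ^ k) + C l}) =
        2 * p ^ k := by
  haveI := charP_residueField_unitBall p E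
  exact free_finrank_quotient_span_of_order_eq p E _ (2 * p ^ k)
    (order_map_eulerQuadratic_of_eq_zero_of_eq_zero p k h h')

/-- **`λ(Λ_𝒪/((ℓ − aY))) = 0` when `ℓ̄ ≠ ā`**: the quotient is free of rank `0` over `𝒪 = 𝒪_E`.
[cite: GreenbergVatsal2000, §2 Prop. 2.4] [cite: Washington1997, §7.1 Thm. 7.3] -/
theorem free_finrank_quotient_span_eulerLinear_of_ne (k : ℕ) {a l : PadicIntermediateField.unitBall p E}
    (h : IsLocalRing.residue (PadicIntermediateField.unitBall p E) l ≠
      IsLocalRing.residue (PadicIntermediateField.unitBall p E) a) :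
    Module.Free (PadicIntermediateField.unitBall p E)
        (PowerSeries (PadicIntermediateField.unitBall p E) ⧸
          Ideal.span {C l - C a * ((1 : PowerSeries (PadicIntermediateField.unitBall p E)) + X) ^ (p ^ k)}) ∧
      Module.Finite (PadicIntermediateField.unitBall p E)
        (PowerSeries (PadicIntermediateField.unitBall p E) ⧸
          Ideal.span {C l - C a * ((1 : PowerSeries (PadicIntermediateField.unitBall p E)) + X) ^ (p ^ k)}) ∧
      Module.finrank (PadicIntermediateField.unitBall p E)
        (PowerSeries (PadicIntermediateField.unitBall p E) ⧸
          Ideal.span {C l - C a * ((1 : PowerSeries (PadicIntermediateField.unitBall p E)) + X) ^ (p ^ k)}) =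
        0 := by
  haveI := charP_residueField_unitBall p E
  exact free_finrank_quotient_span_of_order_eq p E _ 0 (order_map_eulerLinear_of_ne p k h)

/-- **`λ(Λ_𝒪/((ℓ − aY))) = p^k` when `ℓ̄ = ā ≠ 0`**: the quotient is free of rank `p^k` over `𝒪 = 𝒪_E`.
[cite: GreenbergVatsal2000, §2 Prop. 2.4] [cite: Washington1997, §7.1 Thm. 7.3] -/
theorem free_finrank_quotient_span_eulerLinear_of_eq (k : ℕ) {a l : PadicIntermediateField.unitBall p E}
    (h : IsLocalRing.residue (PadicIntermediateField.unitBall p E) l =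
      IsLocalRing.residue (PadicIntermediateField.unitBall p E) a)
    (h0 : IsLocalRing.residue (PadicIntermediateField.unitBall p E) a ≠ 0) :
    Module.Free (PadicIntermediateField.unitBall p E)
        (PowerSeries (PadicIntermediateField.unitBall p E) ⧸
          Ideal.span {C l - C a * ((1 : PowerSeries (PadicIntermediateField.unitBall p E)) + X) ^ (p ^ k)}) ∧
      Module.Finite (PadicIntermediateField.unitBall p E)
        (PowerSeries (PadicIntermediateField.unitBall p E) ⧸
          Ideal.span {C l - C a * ((1 : PowerSeries (PadicIntermediateField.unitBall p E)) + X) ^ (p ^ k)}) ∧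
      Module.finrank (PadicIntermediateField.unitBall p E)
        (PowerSeries (PadicIntermediateField.unitBall p E) ⧸
          Ideal.span {C l - C a * ((1 : PowerSeries (PadicIntermediateField.unitBall p E)) + X) ^ (p ^ k)}) =
        p ^ k := by
  haveI := charP_residueField_unitBall p E
  exact free_finrank_quotient_span_of_order_eq p E _ (p ^ k) (order_map_eulerLinear_of_eq p k h h0)

end UnitBall

end Summit.BirchSwinnertonDyer.BirchSwinnertonDyer.Theorems.LambdaLowerBoundO

end
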